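import Summits.QuantumAdvantage.QuantumAdvantage.Theorems.CharDialCountDialA
import HarnessLib

/-!
# CharDial ▸ CountDial, part C — the Boolean bootstrap (3-cycle ⟹ transposition), `AlmostFewTypesTwoOdd`, `SmallOrbitYoung`,
# the residual `ExactFromAlmostTwoOdd`, `closes`-shape junctions, LEMMA Z typed

Part C of «CountDial» (NODE-g24.md §0–§5): ★ `sw_of_cyc3` — on BINARY words, invariance of a cut under the 3-cycle `(x y z)` in both
orientations gives invariance under the transposition `(x y)` (the third letter agrees with one of the two); `CycInvOff`, `sw_of_cycInv`;
the pieces `AlmostFew`/`AlmostFewTypesAt`/★ `AlmostFewTypesTwoOdd` (all but a `1/k` fraction of the coordinates in `≤ K(p,k)` classes — WEAKER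
than the leaf, `almostFewTypes_of_fewTypes`), ★ `SmallOrbitYoung` (support, permutation-group shape; paper proof NODE-g24 §4 modulo LEMMA Z =
`MinDegFourSmall`, typed here), the junction ★ `almostFewTypes_of_expCount : EC → SOY → AFT`, the residual ★ `ExactFromAlmostTwoOdd := AFT →
FewTypesTwoOdd` and the `closes`-shape theorems `fewTypes_of_pieces : EC → SOY → X → Leaf`, `structureLaw_of_pieces : PF → EC → SOY → X → B`,
`pieces_of_structureLaw : B → EC ∧ AFT ∧ X` (exact carving up to the support).  The Z-free primary carving is part D.

Kernel standard: no placeholders; axioms [propext, Classical.choice, Quot.sound] only (guards at the end); closed computations by kernel `decide`.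
-/

set_option autoImplicit false
set_option linter.dupNamespace false

namespace Summit.QuantumAdvantage.QuantumAdvantage.Theorems.CountDial

open Classical
open Finset
open Summit.QuantumAdvantage.AdviceFreeQNC0
open Literature.Computability.MetaComplexity Literature.Computability.MetaComplexity.Smolensky
open Summit.QuantumAdvantage.QuantumAdvantage.Theorems.TransferDial

/-! ## §5 3-cycle invariance on a block IS exchangeability (kernel, binary alphabet) -/

section Alt
variable {m : ℕ}
open Summit.QuantumAdvantage.QuantumAdvantage.Theorems.TransferDial.JumpSym (cyc swap_eq_cyc swap_eq_cyc' swap_eq_self)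

/-- `f` is invariant under the 3-cycles of positions inside the colour class of `c` off `E` (what a subgroup `≥ A_X` of the stabiliser gives). -/
def CycInvOff (f : (Fin m → Bool) → Bool) (E : Finset (Fin m)) {K : ℕ} (c : Fin m → Fin K) : Prop :=
  ∀ a b r : Fin m, a ∉ E → b ∉ E → r ∉ E → c a = c b → c b = c r → a ≠ b → b ≠ r → a ≠ r → ∀ u, f (cyc a b r u) = f u

/-- ★ On BINARY words, invariance under the 3-cycles through `a`, `b` and a third position `r` gives invariance under the transposition
`(a b)`: the third letter agrees with one of the two. -/
theorem sw_of_cyc3 (f : (Fin m → Bool) → Bool) {a b r : Fin m} (hab : a ≠ b) (hbr : b ≠ r) (har : a ≠ r)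
    (h1 : ∀ u, f (cyc a b r u) = f u) (h2 : ∀ u, f (cyc b a r u) = f u) : Sw f a b := by
  intro u
  by_cases hu : u a = u b
  · have e : (u ∘ Equiv.swap a b) = u := swap_eq_self a b u hu
    rw [e]
  · by_cases hr : u r = u a
    · have e : (u ∘ Equiv.swap a b) = cyc a b r u := swap_eq_cyc a b r hab hbr har u hr
      rw [e, h1]
    · have hr' : u r = u b := by
        revert hu hr; cases u a <;> cases u b <;> cases u r <;> simp
      have e : (u ∘ Equiv.swap a b) = cyc b a r u := swap_eq_cyc' a b r hab hbr har u hr'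
      rw [e, h2]

/-- ★ If `f` is 3-cycle-invariant on the colour classes off `E` and every class off `E` has `≥ 3` members off `E`, then
«same colour off `E` ⟹ exchangeable». -/
theorem sw_of_cycInv (f : (Fin m → Bool) → Bool) (E : Finset (Fin m)) {K : ℕ} (c : Fin m → Fin K) (hc : CycInvOff f E c)
    (h3 : ∀ i ∉ E, 3 ≤ (univ.filter fun j : Fin m => j ∉ E ∧ c j = c i).card) :
    ∀ i ∉ E, ∀ j ∉ E, c i = c j → Sw f i j := by
  intro i hi j hj hij
  by_cases hne : i = j
  · subst hne; exact sw_refl f i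
  -- a third member of the class
  have hbig := h3 i hi
  have hsub : ({i, j} : Finset (Fin m)) ⊆ univ.filter fun k : Fin m => k ∉ E ∧ c k = c i := by
    intro k hk
    rw [mem_insert, mem_singleton] at hk
    rw [mem_filter]
    rcases hk with rfl | rfl
    · exact ⟨mem_univ _, hi, rfl⟩
    · exact ⟨mem_univ _, hj, hij.symm⟩
  have hcard2 : ({i, j} : Finset (Fin m)).card = 2 := card_pair hne
  obtain ⟨r, hr, hrij⟩ : ∃ r ∈ univ.filter (fun k : Fin m => k ∉ E ∧ c k = c i), r ∉ ({i, j} : Finset (Fin m)) := by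
    by_contra hcon
    push Not at hcon
    have : (univ.filter fun k : Fin m => k ∉ E ∧ c k = c i) ⊆ {i, j} := fun k hk => hcon k hk
    have := card_le_card this
    omega
  rw [mem_filter] at hr
  rw [mem_insert, mem_singleton, not_or] at hrij
  have hir : i ≠ r := fun h => hrij.1 h.symm
  have hjr : j ≠ r := fun h => hrij.2 h.symm
  refine sw_of_cyc3 f hne hjr hir ?_ ?_
  · exact hc i j r hi hj hr.2.1 hij (hij.symm.trans hr.2.2.symm) hne hjr hir
  · exact hc j i r hj hi hr.2.1 hij.symm hr.2.2.symm (Ne.symm hne) hir hjr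

end Alt

/-! ## §6 The pieces beneath EC (typed) and the kernel junction EC ∧ SmallOrbitYoung ⟹ ALMOST-FEW-TYPES -/

/-- ALMOST-FEW shape of one cut with parameters `(k, K)`: an exceptional set `E` with `k·|E| ≤ m + K` and a `K`-colouring of the
coordinates with «same colour off `E` ⟹ exchangeable». -/
def AlmostFew {m : ℕ} (f : (Fin m → Bool) → Bool) (k K : ℕ) : Prop :=
  ∃ E : Finset (Fin m), k * E.card ≤ m + K ∧ ∃ c : Fin m → Fin K, ∀ i ∉ E, ∀ j ∉ E, c i = c j → Sw f i j

/-- ALMOST-FEW-TYPES at degree `d`: for every `k`, every degree-≤ d cut is almost-few with parameters `(k, K(k))`. -/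
def AlmostFewTypesAt (p : ℕ) [Fact p.Prime] (d : ℕ) : Prop :=
  ∀ k : ℕ, ∃ K : ℕ, ∀ (m : ℕ) (f : (Fin m → Bool) → Bool), HasDegF p f d → AlmostFew f k K

/-- ★ `AlmostFewTypesTwoOdd` — all but a `1/k` fraction of the coordinates of a degree-≤(2p−3) cut lie in `≤ K(p,k)` exchangeability
classes (WEAKER than the leaf: `almostFewTypes_of_fewTypes`; PROVED from EC ∧ SmallOrbitYoung: `almostFewTypes_of_expCount`). -/
def AlmostFewTypesTwoOdd : Prop := ∀ (p : ℕ) [Fact p.Prime], 5 ≤ p → AlmostFewTypesAt p (2 * p - 3)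

/-- ★ PIECE SOY — `SmallOrbitYoung` (permutation-group SHAPE statement, support, not a crux; paper proof NODE-g24.md §4 = entropy count
over the exchangeability partition [complete] + LEMMA Z `MinDegFourSmall` [Dixon–Mortimer, *Permutation Groups* (1996) Thm 5.2A covers
index `< ½·binom(t, t/2)`; general case reference wanted, ask CD-3]; also uses Praeger–Saxl 1980 / Maróti 2002 only through LEMMA Z):
if a cut has `≤ C^{m+1}` coordinate-permutes then, for every `k`, all but `(m + K)/k` coordinates are covered by `≤ K = K(C,k)` colour
classes, each with `≥ 3` members, on which the cut is invariant under the 3-cycles of positions (`A_X ≤ Stab f`). -/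
def SmallOrbitYoung : Prop :=
  ∀ C k : ℕ, ∃ K : ℕ, ∀ (m : ℕ) (f : (Fin m → Bool) → Bool), (orbitS f).card ≤ C ^ (m + 1) →
    ∃ E : Finset (Fin m), k * E.card ≤ m + K ∧ ∃ c : Fin m → Fin K, CycInvOff f E c ∧
      ∀ i ∉ E, 3 ≤ (univ.filter fun j : Fin m => j ∉ E ∧ c j = c i).card

section Junction
variable {p : ℕ} [hp : Fact p.Prime]

/-- ★ ORBIT BOUND ∧ SOY ⟹ ALMOST-FEW-TYPES (kernel, pointwise in the degree). -/
theorem almostFewTypesAt_of_orbitBound {d C : ℕ} (hS : SmallOrbitYoung) (hO : OrbitBoundAt p d C) : AlmostFewTypesAt p d := by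
  intro k
  obtain ⟨K, hK⟩ := hS C k
  refine ⟨K, fun m f hf => ?_⟩
  obtain ⟨E, hE, c, hc, h3⟩ := hK m f (hO m f hf)
  exact ⟨E, hE, c, sw_of_cycInv f E c hc h3⟩

/-- ★ EC ∧ SOY ⟹ `AlmostFewTypesTwoOdd` (kernel). -/
theorem almostFewTypes_of_expCount (hE : ExpCountTwoOdd) (hS : SmallOrbitYoung) : AlmostFewTypesTwoOdd := by
  intro p _ hp5
  obtain ⟨C, hC⟩ := hE p hp5
  exact almostFewTypesAt_of_orbitBound hS (orbitBound_of_expCount hC)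

/-- Few types ⟹ almost-few (`E = ∅`): the almost-statement is WEAKER than (implied by) the leaf. -/
theorem almostFew_of_colouring {m N : ℕ} (f : (Fin m → Bool) → Bool) (c : Fin m → Fin N) (hc : ∀ i j, c i = c j → Sw f i j) (k : ℕ) :
    AlmostFew f k N :=
  ⟨∅, by simp, c, fun i _ j _ h => hc i j h⟩

/-- ★ Leaf ⟹ `AlmostFewTypesTwoOdd` (kernel): the almost-statement is WEAKER than the leaf. -/
theorem almostFewTypes_of_fewTypes (h : FewTypesTwoOdd) : AlmostFewTypesTwoOdd := by
  intro p _ hp5 k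
  obtain ⟨N, hN⟩ := h p hp5
  refine ⟨N, fun m f hf => ?_⟩
  obtain ⟨c, hc⟩ := hN m f hf
  exact almostFew_of_colouring f c hc k

end Junction

/-! ## §7 The residual and `closes` -/

/-- ★ THE RESIDUAL `ExactFromAlmostTwoOdd` — «almost few types ⟹ few types» at degree `2p − 3` (WEAKER: not known to imply the leaf —
it is the leaf RELATIVE to an almost-symmetry theorem; its pointwise form contains rung FT(2p−4) by selector padding, NODE-g24.md §5;
leaf tag IDEA-NEEDED: from a `1/k` exceptional fraction to `O(1)` exceptional coordinates — the tree's `LocalToGlobalTwoOdd` is the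
`O(1)` end). -/
def ExactFromAlmostTwoOdd : Prop := AlmostFewTypesTwoOdd → FewTypesTwoOdd

/-- ★ `closes`-shape junction (kernel): Leaf ⟸ EC ∧ SOY ∧ ExactFromAlmost. -/
theorem fewTypes_of_pieces (hE : ExpCountTwoOdd) (hS : SmallOrbitYoung) (hX : ExactFromAlmostTwoOdd) : FewTypesTwoOdd :=
  hX (almostFewTypes_of_expCount hE hS)

/-- … and on to piece B through the tree (PF = the field core, paper-proved g22): B ⟸ PF ∧ EC ∧ SOY ∧ ExactFromAlmost. -/
theorem structureLaw_of_pieces (hPF : FieldCorePerPrime) (hE : ExpCountTwoOdd) (hS : SmallOrbitYoung)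
    (hX : ExactFromAlmostTwoOdd) : StructureLawTwoOdd :=
  closes_of_PF hPF (partners_of_fewTypes (fewTypes_of_pieces hE hS hX))

/-- Conversely every piece except SOY is implied by B (EC: `expCount_of_structureLaw`; Almost and hence the residual's conclusion:
`almostFewTypes_of_fewTypes ∘ fewTypes_of_structureLaw`). -/
theorem pieces_of_structureLaw (hB : StructureLawTwoOdd) : ExpCountTwoOdd ∧ AlmostFewTypesTwoOdd ∧ ExactFromAlmostTwoOdd :=
  ⟨expCount_of_structureLaw hB, almostFewTypes_of_fewTypes (fewTypes_of_structureLaw hB), fun _ => fewTypes_of_structureLaw hB⟩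


/-- LEMMA Z of NODE-g24.md §4, typed (support, pure permutation-group theory; the one external input of the paper proof of
`SmallOrbitYoung`): a permutation group on `t` points in which every non-identity element moves `≥ 4` points (no transpositions, no
3-cycles) has order `≤ c^{t+1} · (t!)^{1 − 1/(q+1)}`.  Extremal shape: the diagonal `S_{t/2}` on two copies (`(t/2)! ≈ √(t!)`). -/
def MinDegFourSmall : Prop :=
  ∃ q c : ℕ, ∀ (t : ℕ) (H : Subgroup (Equiv.Perm (Fin t))),
    (∀ h ∈ H, h ≠ 1 → 4 ≤ h.support.card) → (Nat.card H) ^ (q + 1) ≤ c ^ (t + 1) * (Nat.factorial t) ^ q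

/-! ### Axiom guards -/

/-- info: 'Summit.QuantumAdvantage.QuantumAdvantage.Theorems.CountDial.structureLaw_of_pieces' depends on axioms: [propext,
 choice,
 Quot.sound] -/
#guard_msgs in #print axioms structureLaw_of_pieces

/-- info: 'Summit.QuantumAdvantage.QuantumAdvantage.Theorems.CountDial.fewTypes_of_pieces' depends on axioms: [propext,
 choice,
 Quot.sound] -/
#guard_msgs in #print axioms fewTypes_of_pieces

/-- info: 'Summit.QuantumAdvantage.QuantumAdvantage.Theorems.CountDial.pieces_of_structureLaw' depends on axioms: [propext,
 choice,
 Quot.sound] -/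
#guard_msgs in #print axioms pieces_of_structureLaw

/-- info: 'Summit.QuantumAdvantage.QuantumAdvantage.Theorems.CountDial.almostFewTypes_of_expCount' depends on axioms: [propext,
 choice,
 Quot.sound] -/
#guard_msgs in #print axioms almostFewTypes_of_expCount

/-- info: 'Summit.QuantumAdvantage.QuantumAdvantage.Theorems.CountDial.almostFewTypes_of_fewTypes' depends on axioms: [propext,
 choice,
 Quot.sound] -/
#guard_msgs in #print axioms almostFewTypes_of_fewTypes

/-- info: 'Summit.QuantumAdvantage.QuantumAdvantage.Theorems.CountDial.sw_of_cycInv' depends on axioms: [propext,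
 choice,
 Quot.sound] -/
#guard_msgs in #print axioms sw_of_cycInv

end Summit.QuantumAdvantage.QuantumAdvantage.Theorems.CountDial
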